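import Literature.Analysis.FunctionSpaces.LittlewoodPaleyKernel
import Literature.Analysis.FunctionSpaces.LittlewoodPaleySquareFunction
import Literature.Analysis.FluidPDE.LittlewoodPaleyBlockFn
import Literature.Analysis.FunctionSpaces.LittlewoodPaleySmooth
import Literature.Analysis.FluidPDE.NSCriticalClosureBesovProofs
import HarnessLib

/-!
# Littlewood–Paley blocks of real vector fields: the dictionary with tempered distributions

Analysis/FluidPDE support file (serves the discharge of
`Literature.Analysis.FluidPDE.cheskidov_shvydkoy`, ns.S31). The hypothesis of Cheskidov–Shvydkoy's
Lemma 3.2 (`Literature.Analysis.FluidPDE.cheskidov_shvydkoy_dyadic_regular`) is phrased through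
the tempered distributions `U t` of the slices of a Leray–Hopf solution (`IsDistributionOf (u t) (U t)`)
and the distributional blocks `FunctionSpaces.lpBlock j (U t)`, whereas the frequency-localised
energy estimate of its proof manipulates the blocks as functions. This file is the dictionary
between the two worlds for real fields `v : E → ℝ^ι`, all **proved**:

* building on the function-level dictionary of `LittlewoodPaleyBlockFn.lean`
  (`IsDistributionOf.blockFn`, `IsDistributionOf.eLpNormDistrib_lpBlock_eq`,
  `tendsto_eLpNorm_sub_sum_blockFn`): the norm identities
  `eLpNormDistrib p (Δ̇_j V) = ‖Δ̇_j v‖_{L^p}` (`IsDistributionOf.eLpNormDistrib_lpBlock_eq_self`,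
  `_top`) and `lpBlockWeight s ∞ V j = 2^{js} ‖Δ̇_j v‖_{L^∞}` (the dyadic weight of CS Lemma 3.2);
  derivatives of blocks (`IsDistributionOf.fderiv_blockFn`: `D(Δ̇_j v) m = Δ̇_j (∂_m v)` represents
  `∂_m Δ̇_j V`);
* transferred from the accepted distributional theory: the **square function theorem** for real
  fields (`tsum_eLpNorm_blockFn_sq_le`: `∑_j ‖Δ̇_j v‖²₂ ≤ 8‖v‖²₂`;
  `eLpNorm_sq_le_two_mul_tsum_eLpNorm_blockFn_sq`: `‖v‖²₂ ≤ 2 ∑_j ‖Δ̇_j v‖²₂`), **Bernstein**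
  `L² → L^∞` in the `2⁻¹`-exponent form consumed by `LPBounds.sup_le`
  (`exists_eLpNorm_top_blockFn_le`, a corollary of `exists_eLpNorm_top_blockFn_le_eLpNorm 2`),
  boundedness on `L²` (`exists_eLpNorm_blockFn_two_le`), Bernstein for derivatives
  (`exists_eLpNorm_fderiv_blockFn_le`) and **reverse Bernstein**
  (`exists_eLpNorm_blockFn_le_sum_fderiv`), the last two for fields in the class `IsC1L2Field`
  (`C¹`, bounded with bounded derivative, `v, ∂_m v ∈ L²`; every `IsSmoothL2Field` is one,
  `IsC1L2Field.of_isSmoothL2Field`), in which the derivative dictionary holds.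

## References

* H. Bahouri, J.-Y. Chemin, R. Danchin, *Fourier Analysis and Nonlinear PDE*, Springer 2011,
  Lemma 2.1, Prop. 2.12, §2.2. [BahouriCheminDanchin2011]
* R. Danchin, Fourier analysis methods for the compressible Navier–Stokes equations (2018),
  Prop. 2.1 (reverse Bernstein). [Danchin2018FourierCNS]
* A. Cheskidov, R. Shvydkoy, Arch. Ration. Mech. Anal. 195 (2010), §2.1 and Lemma 3.2
  (arXiv:0708.3067, pp. 4–5). [CheskidovShvydkoy2010]
-/

noncomputable section

open MeasureTheory FourierTransform SchwartzMap Real Filter Topology Function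
open Literature.Analysis.FunctionSpaces
open scoped FourierTransform RealInnerProductSpace ENNReal NNReal Convolution

namespace Literature.Analysis.FluidPDE

section Dictionary

variable {ι : Type*} [Fintype ι]
variable {E : Type*} [NormedAddCommGroup E] [InnerProductSpace ℝ E] [FiniteDimensional ℝ E]
  [MeasurableSpace E] [BorelSpace E]











/-- The case `q = p`: `eLpNormDistrib p (Δ̇_j V) = ‖Δ̇_j v‖_{L^p}`. [folklore] -/
theorem IsDistributionOf.eLpNormDistrib_lpBlock_eq_self {p : ℝ≥0∞} [Fact (1 ≤ p)]
    {v : E → EuclideanSpace ℝ ι} {V : 𝓢'(E, EuclideanSpace ℂ ι)} (hV : IsDistributionOf v V)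
    (hv : MemLp v p volume) (j : ℤ) :
    FunctionSpaces.eLpNormDistrib p (FunctionSpaces.lpBlock j V) =
      eLpNorm (FunctionSpaces.blockFn j v) p volume :=
  hV.eLpNormDistrib_lpBlock_eq hv j (memLp_blockFn j hv Fact.out)

/-- The case `q = ∞`: `eLpNormDistrib ∞ (Δ̇_j V) = ‖Δ̇_j v‖_{L^∞}`. [folklore] -/
theorem IsDistributionOf.eLpNormDistrib_top_lpBlock_eq {p : ℝ≥0∞} [Fact (1 ≤ p)]
    {v : E → EuclideanSpace ℝ ι} {V : 𝓢'(E, EuclideanSpace ℂ ι)} (hV : IsDistributionOf v V)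
    (hv : MemLp v p volume) (j : ℤ) :
    FunctionSpaces.eLpNormDistrib ∞ (FunctionSpaces.lpBlock j V) =
      eLpNorm (FunctionSpaces.blockFn j v) ∞ volume :=
  haveI : Fact (1 ≤ (∞ : ℝ≥0∞)) := ⟨le_top⟩
  hV.eLpNormDistrib_lpBlock_eq hv j (memLp_top_blockFn j hv)

/-- **The dyadic weight of the hypothesis of Cheskidov–Shvydkoy's Lemma 3.2 as a function norm**:
`lpBlockWeight s ∞ V j = 2^{js} ‖Δ̇_j v‖_{L^∞}` for `v ∈ L^p` with distribution `V`
(Cheskidov–Shvydkoy 2010, Lemma 3.2: `λ_q⁻¹ ‖u_q‖_∞`). [folklore] -/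
theorem IsDistributionOf.lpBlockWeight_top_eq {p : ℝ≥0∞} [Fact (1 ≤ p)]
    {v : E → EuclideanSpace ℝ ι} {V : 𝓢'(E, EuclideanSpace ℂ ι)} (hV : IsDistributionOf v V)
    (hv : MemLp v p volume) (s : ℝ) (j : ℤ) :
    FunctionSpaces.lpBlockWeight s ∞ V j =
      (2 : ℝ≥0∞) ^ ((j : ℝ) * s) * eLpNorm (FunctionSpaces.blockFn j v) ∞ volume := by
  haveI : Fact (1 ≤ (∞ : ℝ≥0∞)) := ⟨le_top⟩
  rw [FunctionSpaces.lpBlockWeight, hV.eLpNormDistrib_top_lpBlock_eq hv]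

/-- **Derivatives of blocks through the distribution**: for a `C¹` field `v ∈ L²` with
`∂_m v ∈ L²`, `v` and `Dv` bounded, and distribution `V`, the field `x ↦ D(Δ̇_j v)(x) m` is
`Δ̇_j (∂_m v)` and its distribution is `∂_m (Δ̇_j V)`. [folklore] -/
theorem IsDistributionOf.fderiv_blockFn {v : E → EuclideanSpace ℝ ι} {V : 𝓢'(E, EuclideanSpace ℂ ι)}
    (hV : IsDistributionOf v V) (hv : ContDiff ℝ 1 v) (hv2 : MemLp v 2 volume) {M₀ M₁ : ℝ}
    (hM₀ : ∀ x, ‖v x‖ ≤ M₀) (hM₁ : ∀ x, ‖fderiv ℝ v x‖ ≤ M₁) (m : E)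
    (hvm : MemLp (fun x => fderiv ℝ v x m) 2 volume) (j : ℤ) :
    IsDistributionOf (fun x => fderiv ℝ (FunctionSpaces.blockFn j v) x m)
      (LineDeriv.lineDerivOp m (FunctionSpaces.lpBlock j V)) := by
  haveI : Fact (1 ≤ (∞ : ℝ≥0∞)) := ⟨le_top⟩
  have hD : MemLp (fderiv ℝ v) ∞ volume :=
    memLp_top_of_bound (hv.continuous_fderiv one_ne_zero).aestronglyMeasurable M₁
      (Eventually.of_forall hM₁)
  have h1 : (fun x => fderiv ℝ (FunctionSpaces.blockFn j v) x m) =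
      FunctionSpaces.blockFn j (fun x => fderiv ℝ v x m) := by
    rw [FunctionSpaces.fderiv_blockFn j hv hM₀ hM₁]
    exact (blockFn_comp_clm j (ContinuousLinearMap.apply ℝ (EuclideanSpace ℝ ι) m) hD).symm
  rw [h1, ← FunctionSpaces.lpBlock_lineDeriv_comm]
  exact (hV.lineDeriv hv hv2 m hvm).blockFn hvm j

end Dictionary

/-! ## The square function theorem and Bernstein's inequalities for blocks of real fields -/

section Transfer

variable {ι : Type*} [Fintype ι]
variable {E : Type*} [NormedAddCommGroup E] [InnerProductSpace ℝ E] [FiniteDimensional ℝ E]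
  [MeasurableSpace E] [BorelSpace E]

/-- The `L²` class of the complexified field has the `L²` norm of the field. [folklore] -/
theorem enorm_toLp_complexify {v : E → EuclideanSpace ℝ ι} (hv : MemLp v 2 volume) :
    ‖((memLp_complexify_comp hv).toLp _ : Lp (EuclideanSpace ℂ ι) 2 (volume : Measure E))‖ₑ =
      eLpNorm v 2 volume := by
  rw [Lp.enorm_toLp]
  exact eLpNorm_congr_norm_ae (Eventually.of_forall fun x => EuclideanSpace.norm_complexify _)

/-- **Square function theorem for real fields, upper bound**: `∑_j ‖Δ̇_j v‖²_{L²} ≤ 8 ‖v‖²_{L²}`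
for `v ∈ L²(E; ℝ^ι)` (`Literature.Analysis.FunctionSpaces.tsum_eLpNormDistrib_lpBlock_sq_le` through
the dictionary). [cite: BahouriCheminDanchin2011, Prop. 2.12] -/
theorem tsum_eLpNorm_blockFn_sq_le {v : E → EuclideanSpace ℝ ι} (hv : MemLp v 2 volume) :
    ∑' j : ℤ, eLpNorm (FunctionSpaces.blockFn j v) 2 volume ^ 2 ≤ 8 * eLpNorm v 2 volume ^ 2 := by
  have hV : IsDistributionOf v _ := isDistributionOf_toTemperedDistribution hv
  have h := FunctionSpaces.tsum_eLpNormDistrib_lpBlock_sq_le (E := E) (F := EuclideanSpace ℂ ι)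
    ((memLp_complexify_comp hv).toLp _)
  simp_rw [hV.eLpNormDistrib_lpBlock_eq_self hv, enorm_toLp_complexify hv] at h
  exact h

/-- **Square function theorem for real fields, lower bound**: `‖v‖²_{L²} ≤ 2 ∑_j ‖Δ̇_j v‖²_{L²}`
for `v ∈ L²(E; ℝ^ι)` on a space of positive dimension. [cite: BahouriCheminDanchin2011, Prop. 2.12] -/
theorem eLpNorm_sq_le_two_mul_tsum_eLpNorm_blockFn_sq [Nontrivial E] {v : E → EuclideanSpace ℝ ι}
    (hv : MemLp v 2 volume) :
    eLpNorm v 2 volume ^ 2 ≤ 2 * ∑' j : ℤ, eLpNorm (FunctionSpaces.blockFn j v) 2 volume ^ 2 := by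
  have hV : IsDistributionOf v _ := isDistributionOf_toTemperedDistribution hv
  have h := FunctionSpaces.enorm_sq_le_two_mul_tsum_eLpNormDistrib_lpBlock_sq (E := E)
    (F := EuclideanSpace ℂ ι) ((memLp_complexify_comp hv).toLp _)
  simp_rw [hV.eLpNormDistrib_lpBlock_eq_self hv, enorm_toLp_complexify hv] at h
  exact h



/-- **Bernstein `L² → L^∞` on blocks of real fields**: there is `C` with
`‖Δ̇_j v‖_{L^∞} ≤ C 2^{jd/2} ‖v‖_{L²}` for all `j` and `v ∈ L²(E; ℝ^ι)`, `d = dim E` — the case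
`p = 2` of `exists_eLpNorm_top_blockFn_le_eLpNorm` (`LittlewoodPaleyBlockFn.lean`), with the
exponent written `2⁻¹` as consumed by `LPBounds.sup_le`. [cite: BahouriCheminDanchin2011, Lemma 2.1] -/
theorem exists_eLpNorm_top_blockFn_le :
    ∃ C : ℝ≥0, ∀ (j : ℤ) (v : E → EuclideanSpace ℝ ι), MemLp v 2 volume →
      eLpNorm (FunctionSpaces.blockFn j v) ∞ volume ≤
        C * (2 : ℝ≥0∞) ^ ((j : ℝ) * Module.finrank ℝ E * 2⁻¹) * eLpNorm v 2 volume := by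
  obtain ⟨C, hC⟩ := exists_eLpNorm_top_blockFn_le_eLpNorm (E := E) (ι := ι) 2
  refine ⟨C, fun j v hv => ?_⟩
  have h := hC j hv
  rwa [ENNReal.toReal_ofNat] at h

/-- **Boundedness of the blocks on `L²` for real fields**: `‖Δ̇_j v‖_{L²} ≤ C ‖v‖_{L²}`
(uniform `L^p` bound of the blocks, BCD (2.5)). [cite: BahouriCheminDanchin2011, Lemma 2.1] -/
theorem exists_eLpNorm_blockFn_two_le :
    ∃ C : ℝ≥0, ∀ (j : ℤ) (v : E → EuclideanSpace ℝ ι), MemLp v 2 volume →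
      eLpNorm (FunctionSpaces.blockFn j v) 2 volume ≤ C * eLpNorm v 2 volume := by
  obtain ⟨C₂, hC₂⟩ := exists_eLpNormDistrib_lpBlock_le_eLpNormDistrib (E := E)
    (F := EuclideanSpace ℂ ι) 2
  refine ⟨C₂, fun j v hv => ?_⟩
  have hV : IsDistributionOf v _ := isDistributionOf_toTemperedDistribution hv
  have h2 := hC₂ j (((memLp_complexify_comp hv).toLp _ : Lp (EuclideanSpace ℂ ι) 2 (volume : Measure E)) :
    𝓢'(E, EuclideanSpace ℂ ι))
  rwa [hV.eLpNormDistrib_lpBlock_eq_self hv, FunctionSpaces.eLpNormDistrib_coe, enorm_toLp_complexify hv] at h2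

/-- The hypotheses under which the blocks of a real field can be differentiated and measured in
`L²` through the dictionary: `v` is `C¹`, `v` and `Dv` are bounded, and `v`, `∂_m v` are in `L²`
for every direction `m`. [folklore] -/
structure IsC1L2Field (v : E → EuclideanSpace ℝ ι) : Prop where
  /-- `v` is `C¹`. -/
  contDiff : ContDiff ℝ 1 v
  /-- `v ∈ L²`. -/
  memLp : MemLp v 2 volume
  /-- `v` is bounded. -/
  bounded : ∃ M : ℝ, ∀ x, ‖v x‖ ≤ M
  /-- `Dv` is bounded. -/
  bounded_fderiv : ∃ M : ℝ, ∀ x, ‖fderiv ℝ v x‖ ≤ M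
  /-- `∂_m v ∈ L²` for every `m`. -/
  memLp_fderiv : ∀ m : E, MemLp (fun x => fderiv ℝ v x m) 2 volume

/-- **Every smooth `L²` field is a `C¹`–`L²` field** (the bridge to
`Literature.Analysis.FunctionSpaces.IsSmoothL2Field`, in which `LPBounds` is phrased). [folklore] -/
theorem IsC1L2Field.of_isSmoothL2Field {v : E → EuclideanSpace ℝ ι} (h : IsSmoothL2Field v) : IsC1L2Field v where
  contDiff := h.toHasBoundedDerivs.contDiff_nat 1
  memLp := h.memLp_two
  bounded := h.toHasBoundedDerivs.exists_norm_le
  bounded_fderiv := h.toHasBoundedDerivs.exists_norm_fderiv_le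
  memLp_fderiv := fun m => h.memLp_fderiv_apply m

/-- For a `C¹ ∩ L²` field with bounded derivative, `x ↦ D(Δ̇_j v)(x) m = Δ̇_j(∂_m v)(x)`. (the `C¹` generalisation of
`HasBoundedDerivs.fderiv_blockFn_apply`, `SmoothL2FieldCalculus.lean`). [folklore] -/
theorem IsC1L2Field.fderiv_blockFn_apply {v : E → EuclideanSpace ℝ ι} (h : IsC1L2Field v) (j : ℤ)
    (m : E) : (fun x => fderiv ℝ (FunctionSpaces.blockFn j v) x m) =
      FunctionSpaces.blockFn j (fun x => fderiv ℝ v x m) := by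
  obtain ⟨M₀, hM₀⟩ := h.bounded
  obtain ⟨M₁, hM₁⟩ := h.bounded_fderiv
  haveI : Fact (1 ≤ (∞ : ℝ≥0∞)) := ⟨le_top⟩
  have hD : MemLp (fderiv ℝ v) ∞ volume :=
    memLp_top_of_bound (h.contDiff.continuous_fderiv one_ne_zero).aestronglyMeasurable M₁
      (Eventually.of_forall hM₁)
  rw [FunctionSpaces.fderiv_blockFn j h.contDiff hM₀ hM₁]
  exact (blockFn_comp_clm j (ContinuousLinearMap.apply ℝ (EuclideanSpace ℝ ι) m) hD).symm

/-- The directional derivatives of the blocks of a `C¹ ∩ L²` field are in `L²`. [folklore] -/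
theorem IsC1L2Field.memLp_fderiv_blockFn {v : E → EuclideanSpace ℝ ι} (h : IsC1L2Field v) (j : ℤ)
    (m : E) : MemLp (fun x => fderiv ℝ (FunctionSpaces.blockFn j v) x m) 2 volume := by
  rw [h.fderiv_blockFn_apply j m]
  exact memLp_blockFn j (h.memLp_fderiv m) one_le_two

/-- **Bernstein for derivatives of blocks of real fields** (BCD Lemma 2.1, direct part; accepted
`Literature.Analysis.FunctionSpaces.exists_eLpNormDistrib_lineDeriv_lpBlock_le`): there is `C` with
`‖∂_m Δ̇_j v‖_{L²} ≤ C 2^j ‖m‖ ‖Δ̇_j v‖_{L²}` for every direction `m`, every `j` and every `C¹ ∩ L²`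
field `v` with bounded derivative. [cite: BahouriCheminDanchin2011, Lemma 2.1] -/
theorem exists_eLpNorm_fderiv_blockFn_le :
    ∃ C : ℝ≥0, ∀ (m : E) (j : ℤ) (v : E → EuclideanSpace ℝ ι), IsC1L2Field v →
      eLpNorm (fun x => fderiv ℝ (FunctionSpaces.blockFn j v) x m) 2 volume ≤
        C * ENNReal.ofReal ((2 : ℝ) ^ j * ‖m‖) * eLpNorm (FunctionSpaces.blockFn j v) 2 volume := by
  obtain ⟨C, hC⟩ := FunctionSpaces.exists_eLpNormDistrib_lineDeriv_lpBlock_le (E := E)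
    (F := EuclideanSpace ℂ ι) 2
  refine ⟨C, fun m j v h => ?_⟩
  obtain ⟨M₀, hM₀⟩ := h.bounded
  obtain ⟨M₁, hM₁⟩ := h.bounded_fderiv
  have hV : IsDistributionOf v _ := isDistributionOf_toTemperedDistribution h.memLp
  have h1 := hC m j (((memLp_complexify_comp h.memLp).toLp _ : Lp (EuclideanSpace ℂ ι) 2 (volume : Measure E)) :
    𝓢'(E, EuclideanSpace ℂ ι))
  rwa [(hV.fderiv_blockFn h.contDiff h.memLp hM₀ hM₁ m (h.memLp_fderiv m) j).eLpNormDistrib_eq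
    (h.memLp_fderiv_blockFn j m), hV.eLpNormDistrib_lpBlock_eq_self h.memLp] at h1

/-- **Reverse Bernstein for blocks of real fields** (Danchin 2018, Prop. 2.1; accepted
`Literature.Analysis.FluidPDE.exists_eLpNormDistrib_lpBlock_le_sum_lineDeriv`): for an orthonormal
basis `b` there is `C` with `‖Δ̇_j v‖_{L²} ≤ C 2^{-j} ∑_i ‖∂_{b_i} Δ̇_j v‖_{L²}` for every `j` and
every `C¹ ∩ L²` field `v` with bounded derivative. [cite: Danchin2018FourierCNS, Prop. 2.1] -/
theorem exists_eLpNorm_blockFn_le_sum_fderiv {κ : Type*} [Fintype κ] (b : OrthonormalBasis κ ℝ E) :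
    ∃ C : ℝ≥0, ∀ (j : ℤ) (v : E → EuclideanSpace ℝ ι), IsC1L2Field v →
      eLpNorm (FunctionSpaces.blockFn j v) 2 volume ≤
        C * (2 : ℝ≥0∞) ^ (-(j : ℝ)) *
          ∑ i, eLpNorm (fun x => fderiv ℝ (FunctionSpaces.blockFn j v) x (b i)) 2 volume := by
  obtain ⟨C, hC⟩ := exists_eLpNormDistrib_lpBlock_le_sum_lineDeriv (E := E) (F := EuclideanSpace ℂ ι) 2 b
  refine ⟨C, fun j v h => ?_⟩
  obtain ⟨M₀, hM₀⟩ := h.bounded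
  obtain ⟨M₁, hM₁⟩ := h.bounded_fderiv
  have hV : IsDistributionOf v _ := isDistributionOf_toTemperedDistribution h.memLp
  have h1 := hC j (((memLp_complexify_comp h.memLp).toLp _ : Lp (EuclideanSpace ℂ ι) 2 (volume : Measure E)) :
    𝓢'(E, EuclideanSpace ℂ ι))
  rw [hV.eLpNormDistrib_lpBlock_eq_self h.memLp] at h1
  refine h1.trans_eq ?_
  congr 1
  refine Finset.sum_congr rfl fun i _ => ?_
  rw [FunctionSpaces.lpBlock_lineDeriv_comm,
    (hV.fderiv_blockFn h.contDiff h.memLp hM₀ hM₁ (b i) (h.memLp_fderiv (b i)) j).eLpNormDistrib_eq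
      (h.memLp_fderiv_blockFn j (b i))]

end Transfer

end Literature.Analysis.FluidPDE

end
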